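import Mathlib
import Summits.ABC.ABC.Statement
import Literature.NumberTheory.DiophantineGeometry.PastenSubexpTheorem14
import Literature.Barriers.ABC.BakerMethodBoundsThreeRoutesProofs

/-!
# The `p`-adic door, I: the route through `c` with a general prime factor
(solo-ABC-informed, session 3)

Support file for `SoloInformedDoorB.lean` (see its module docstring for the statement and the
discussion).  Here: the `p`-adic clause of an approximation bound for generator families in
`ℚ^×` in the shape of Pasten's Theorem 2.1(ii) (Invent. Math. 236 (2024), arXiv:2312.03566),
but with a GENERAL factor `F(p)` in place of `p / log p`, is applied to `ξ = −a/b` in the group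
generated by `−1` and all primes of `ab` (threshold `N = 0` in Pasten's §4), giving for an
abc-triple with `ab > 1`
`log c ≤ (∏_{q ∣ ab} K log q) · ∑_{p ∣ c} F(p) (log p + log max{e, 2 log c})`
(`soloInformed_log_le_route_c_F`; the route through `c` of Stewart–Yu, Duke Math. J. 108
(2001), §3), together with the elementary absorption "primes eventually beat `A log p / p^δ`"
(`soloInformed_exists_prod_mul_log_le`).  The hypothesis is written inline; no `Prop` constants
are introduced. [folklore]

## References

* [Pasten2024] H. Pasten, Invent. Math. 236 (2024), 373–385, arXiv:2312.03566 — Theorem 2.1, §§4–5.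
* [StewartYu2001] C. L. Stewart, K. Yu, *On the abc conjecture, II*, Duke Math. J. 108 (2001) — §3.
-/

noncomputable section

open Finset Real Height
open Literature.NumberTheory.DiophantineGeometry
open Literature.NumberTheory.DiophantineGeometry.Dioph
open Literature.NumberTheory.DiophantineGeometry.Pasten
open Literature.Barriers.ABC

namespace Summit.ABC.ABC.Theorems

/-- From a `p`-adic approximation bound for generator families with a general prime factor
`F p` (Pasten's Theorem 2.1(ii) is the case `F p = p / log p`) to the bound for a given element
`ξ = ζ ∏ ξᵢ^{bᵢ} ≠ 1` of the group, with the height product named `Θ`.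
[cite: Pasten2024, Theorem 2.1] -/
theorem soloInformed_padicF_of_family {K : ℝ} {F : ℕ → ℝ}
    (hP : ∀ (ι : Type) [Fintype ι], 0 < Fintype.card ι → ∀ ξ : ι → ℚ,
      (∀ i, ξ i ≠ 0 ∧ ξ i ≠ 1 ∧ ξ i ≠ -1) → ∀ ζ : ℚ, (ζ = 1 ∨ ζ = -1) → ∀ b : ι → ℤ,
      ζ * ∏ i, ξ i ^ b i ≠ 1 → ∀ p : ℕ, p.Prime →
      (padicValRat p (1 - ζ * ∏ i, ξ i ^ b i) : ℝ) * Real.log p <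
        K ^ Fintype.card ι * F p *
          Real.log (max (Real.exp 1) (p * logHeight₁ (ζ * ∏ i, ξ i ^ b i))) *
            ∏ i, logHeight₁ (ξ i))
    (ι : Type) [Fintype ι] (hι : 0 < Fintype.card ι) (ξs : ι → ℚ)
    (hξs : ∀ i, ξs i ≠ 0 ∧ ξs i ≠ 1 ∧ ξs i ≠ -1) (ζ : ℚ) (hζ : ζ = 1 ∨ ζ = -1) (b : ι → ℤ)
    {ξ : ℚ} (hprod : ζ * ∏ i, ξs i ^ b i = ξ) (hξ1 : ξ ≠ 1) {Θ : ℝ}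
    (hΘ : ∏ i, logHeight₁ (ξs i) = Θ) {p : ℕ} (hp : p.Prime) :
    (padicValRat p (1 - ξ) : ℝ) * Real.log p <
      K ^ Fintype.card ι * Θ * (F p * Real.log (max (Real.exp 1) (p * logHeight₁ ξ))) := by
  have hx1 : ζ * ∏ i, ξs i ^ b i ≠ 1 := by rwa [hprod]
  have hN := hP ι hι ξs hξs ζ hζ b hx1 p hp
  rw [hprod, hΘ] at hN
  calc (padicValRat p (1 - ξ) : ℝ) * Real.log p < _ := hN
    _ = _ := by ring

/-- **Route through `c`, one prime, general factor.** For an abc-triple with `ab > 1`, a prime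
`p ∣ c`, and a `p`-adic approximation bound with factor `F p ≥ 0` and constant `K ≥ 0`:
`ν_p(c) · log p < (∏_{q ∣ ab} K log q) · F(p) · (log p + log max{e, 2 log c})`
(`ξ = −a/b` in the group generated by `−1` and the primes of `ab`; `1 − ξ = c/b`).
[cite: Pasten2024, §5] -/
theorem soloInformed_padicF_route_c {K : ℝ} (hK : 0 ≤ K) {F : ℕ → ℝ}
    (hF : ∀ p : ℕ, p.Prime → 0 ≤ F p)
    (hP : ∀ (ι : Type) [Fintype ι], 0 < Fintype.card ι → ∀ ξ : ι → ℚ,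
      (∀ i, ξ i ≠ 0 ∧ ξ i ≠ 1 ∧ ξ i ≠ -1) → ∀ ζ : ℚ, (ζ = 1 ∨ ζ = -1) → ∀ b : ι → ℤ,
      ζ * ∏ i, ξ i ^ b i ≠ 1 → ∀ p : ℕ, p.Prime →
      (padicValRat p (1 - ζ * ∏ i, ξ i ^ b i) : ℝ) * Real.log p <
        K ^ Fintype.card ι * F p *
          Real.log (max (Real.exp 1) (p * logHeight₁ (ζ * ∏ i, ξ i ^ b i))) *
            ∏ i, logHeight₁ (ξ i))
    {a b c : ℕ} (h : IsABCTriple a b c) (h1 : 1 < a * b) {p : ℕ} (hp : p.Prime) (hpc : p ∣ c) :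
    (c.factorization p : ℝ) * Real.log p <
      (∏ q ∈ (a * b).primeFactors, K * Real.log q) *
        (F p * (Real.log p + Real.log (max (Real.exp 1) (2 * Real.log c)))) := by
  classical
  obtain ⟨ha, hb, habc, hcop⟩ := h
  have hc : 0 < c := by omega
  have hbc : b.Coprime c := coprime_right_of_isABCTriple ⟨ha, hb, habc, hcop⟩
  have hb' : (b : ℚ) ≠ 0 := by exact_mod_cast hb.ne'
  have hT : ∀ q ∈ (a * b).primeFactors, q.Prime := fun q hq => Nat.prime_of_mem_primeFactors hq
  have hTne : (a * b).primeFactors.Nonempty := Nat.nonempty_primeFactors.mpr h1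
  have hcard : 0 < Fintype.card ↥(a * b).primeFactors := by
    rw [Fintype.card_coe]; exact hTne.card_pos
  have hgenT : ∀ q ∈ (a * b).primeFactors,
      ((q : ℕ) : ℚ) ≠ 0 ∧ ((q : ℕ) : ℚ) ≠ 1 ∧ ((q : ℕ) : ℚ) ≠ -1 := by
    intro q hq
    have hq' := hT q hq
    refine ⟨by exact_mod_cast hq'.ne_zero, by exact_mod_cast hq'.one_lt.ne', fun h => ?_⟩
    have h0 : (0 : ℚ) ≤ (q : ℚ) := Nat.cast_nonneg q
    rw [h] at h0
    norm_num at h0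
  have hξ1 : (-1 : ℚ) * ((a : ℚ) / b) ≠ 1 := by
    intro h'
    have : (0 : ℚ) < (a : ℚ) / b := div_pos (by exact_mod_cast ha) (by exact_mod_cast hb)
    linarith
  have hprod : (-1 : ℚ) * ∏ i : ↥(a * b).primeFactors, (((i : ℕ) : ℚ)) ^ expDiff a b i =
      (-1 : ℚ) * ((a : ℚ) / b) := by
    rw [cast_div_eq_prod_zpow ha.ne' hb.ne' hcop,
      Finset.prod_coe_sort (a * b).primeFactors fun q => (q : ℚ) ^ expDiff a b q]
  have hhT : ∀ q ∈ (a * b).primeFactors, logHeight₁ ((q : ℕ) : ℚ) = Real.log q := by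
    intro q hq
    haveI : NeZero q := ⟨(hT q hq).ne_zero⟩
    exact Rat.logHeight₁_natCast q
  have hΘ : ∏ i : ↥(a * b).primeFactors, logHeight₁ (((i : ℕ) : ℚ)) =
      ∏ q ∈ (a * b).primeFactors, Real.log q := by
    rw [Finset.prod_coe_sort (a * b).primeFactors fun q => logHeight₁ ((q : ℕ) : ℚ),
      Finset.prod_congr rfl hhT]
  have hN := soloInformed_padicF_of_family hP (↥(a * b).primeFactors) hcard
    (fun i => ((i : ℕ) : ℚ)) (fun i => hgenT i i.2) (-1) (Or.inr rfl) (fun i => expDiff a b i)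
    hprod hξ1 hΘ hp
  rw [Fintype.card_coe] at hN
  have hsub : (1 : ℚ) - (-1) * ((a : ℚ) / b) = (c : ℚ) / b := by
    rw [neg_one_mul, sub_neg_eq_add, eq_div_iff hb', add_mul, div_mul_cancel₀ _ hb', one_mul]
    exact_mod_cast (show b + a = c by omega)
  rw [hsub] at hN
  have hpb : ¬p ∣ b := fun hpb =>
    hp.one_lt.ne' (Nat.dvd_one.mp (hbc.gcd_eq_one ▸ Nat.dvd_gcd hpb hpc))
  have hval : padicValRat p ((c : ℚ) / b) = c.factorization p := by
    haveI : Fact p.Prime := ⟨hp⟩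
    rw [padicValRat.div (by exact_mod_cast hc.ne') hb', padicValRat.of_nat, padicValRat.of_nat,
      padicValNat.eq_zero_of_not_dvd hpb, Nat.factorization_def c hp]
    simp
  rw [hval] at hN
  push_cast at hN
  have hh : logHeight₁ ((-1) * ((a : ℚ) / b)) ≤ 2 * Real.log c := by
    refine (logHeight₁_sign_mul_div_le ha.ne' hb.ne' (Or.inr rfl)).trans ?_
    have h₁ : Real.log a ≤ Real.log c :=
      Real.log_le_log (by exact_mod_cast ha) (by exact_mod_cast (show a ≤ c by omega))
    have h₂ : Real.log b ≤ Real.log c :=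
      Real.log_le_log (by exact_mod_cast hb) (by exact_mod_cast (show b ≤ c by omega))
    linarith
  have hp1 : (1 : ℝ) ≤ p := by exact_mod_cast hp.one_lt.le
  have hlogmax : Real.log (max (Real.exp 1) (p * logHeight₁ ((-1) * ((a : ℚ) / b)))) ≤
      Real.log p + Real.log (max (Real.exp 1) (2 * Real.log c)) :=
    (log_max_exp_mul_le hp1).trans
      (by linarith [log_max_exp_mono (t₁ := logHeight₁ ((-1) * ((a : ℚ) / b))) hh])
  have hprodK : K ^ (a * b).primeFactors.card * ∏ q ∈ (a * b).primeFactors, Real.log (q : ℝ) =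
      ∏ q ∈ (a * b).primeFactors, K * Real.log q := by
    rw [Finset.prod_mul_distrib, Finset.prod_const]
  have hΘ0 : 0 ≤ ∏ q ∈ (a * b).primeFactors, K * Real.log (q : ℝ) :=
    Finset.prod_nonneg fun q hq =>
      mul_nonneg hK (Real.log_nonneg (by exact_mod_cast (hT q hq).one_lt.le))
  calc (c.factorization p : ℝ) * Real.log p
      < K ^ (a * b).primeFactors.card * (∏ q ∈ (a * b).primeFactors, Real.log (q : ℝ)) *
          (F p * Real.log (max (Real.exp 1) (p * logHeight₁ ((-1) * ((a : ℚ) / b))))) := hN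
    _ = (∏ q ∈ (a * b).primeFactors, K * Real.log q) *
          (F p * Real.log (max (Real.exp 1) (p * logHeight₁ ((-1) * ((a : ℚ) / b))))) := by
        rw [hprodK]
    _ ≤ (∏ q ∈ (a * b).primeFactors, K * Real.log q) *
          (F p * (Real.log p + Real.log (max (Real.exp 1) (2 * Real.log c)))) :=
        mul_le_mul_of_nonneg_left (mul_le_mul_of_nonneg_left hlogmax (hF p hp)) hΘ0

/-- **Route through `c`, summed.** For an abc-triple with `ab > 1` and a `p`-adic approximation
bound with factor `F p ≥ 0`:
`log c ≤ (∏_{q ∣ ab} K log q) · ∑_{p ∣ c} F(p) · (log p + log max{e, 2 log c})`.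
[cite: StewartYu2001, §3] -/
theorem soloInformed_log_le_route_c_F {K : ℝ} (hK : 0 ≤ K) {F : ℕ → ℝ}
    (hF : ∀ p : ℕ, p.Prime → 0 ≤ F p)
    (hP : ∀ (ι : Type) [Fintype ι], 0 < Fintype.card ι → ∀ ξ : ι → ℚ,
      (∀ i, ξ i ≠ 0 ∧ ξ i ≠ 1 ∧ ξ i ≠ -1) → ∀ ζ : ℚ, (ζ = 1 ∨ ζ = -1) → ∀ b : ι → ℤ,
      ζ * ∏ i, ξ i ^ b i ≠ 1 → ∀ p : ℕ, p.Prime →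
      (padicValRat p (1 - ζ * ∏ i, ξ i ^ b i) : ℝ) * Real.log p <
        K ^ Fintype.card ι * F p *
          Real.log (max (Real.exp 1) (p * logHeight₁ (ζ * ∏ i, ξ i ^ b i))) *
            ∏ i, logHeight₁ (ξ i))
    {a b c : ℕ} (h : IsABCTriple a b c) (h1 : 1 < a * b) :
    Real.log c ≤ (∏ q ∈ (a * b).primeFactors, K * Real.log q) *
      ∑ p ∈ c.primeFactors, F p * (Real.log p + Real.log (max (Real.exp 1) (2 * Real.log c))) := by
  have hc : c ≠ 0 := by obtain ⟨ha, hb, habc, -⟩ := h; omega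
  calc Real.log c = ∑ p ∈ c.primeFactors, (c.factorization p : ℝ) * Real.log p :=
        log_eq_sum_factorization_mul_log hc
    _ ≤ _ := by
        rw [Finset.mul_sum]
        exact Finset.sum_le_sum fun p hp =>
          (soloInformed_padicF_route_c hK hF hP h h1 (Nat.prime_of_mem_primeFactors hp)
            (Nat.dvd_of_mem_primeFactors hp)).le

/-- **Primes eventually beat `A log p / p^δ`.** For `A ≥ 0` and `δ > 0` there is `C ≥ 1` with
`∏_{p ∈ S} A log p ≤ C · ∏_{p ∈ S} p^δ` for every finite set `S` of primes. [folklore] -/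
theorem soloInformed_exists_prod_mul_log_le {A δ : ℝ} (hA : 0 ≤ A) (hδ : 0 < δ) :
    ∃ C : ℝ, 1 ≤ C ∧ ∀ S : Finset ℕ, (∀ p ∈ S, p.Prime) →
      ∏ p ∈ S, A * Real.log p ≤ C * ∏ p ∈ S, (p : ℝ) ^ δ := by
  classical
  obtain ⟨x₀, hx₀⟩ :=
    Filter.tendsto_atTop_atTop.mp (tendsto_rpow_atTop (half_pos hδ)) (2 * A / δ)
  set N : ℕ := ⌈x₀⌉₊ with hN
  set f : ℕ → ℝ := fun p => A * Real.log p / (p : ℝ) ^ δ with hf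
  set C : ℝ := ∏ p ∈ (Finset.range N).filter Nat.Prime, max 1 (f p) with hC
  have hC1 : 1 ≤ C := Finset.one_le_prod fun p _ => le_max_left _ _
  refine ⟨C, hC1, fun S hS => ?_⟩
  have hf0 : ∀ p ∈ S, 0 ≤ f p := fun p hp => by
    have h1 : (1 : ℝ) ≤ p := by exact_mod_cast (hS p hp).one_lt.le
    exact div_nonneg (mul_nonneg hA (Real.log_nonneg h1)) (Real.rpow_nonneg (by linarith) _)
  have hsplit : ∏ p ∈ S, A * Real.log p = (∏ p ∈ S, f p) * ∏ p ∈ S, (p : ℝ) ^ δ := by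
    rw [← Finset.prod_mul_distrib]
    refine Finset.prod_congr rfl fun p hp => ?_
    have hp0 : (0 : ℝ) < (p : ℝ) ^ δ := Real.rpow_pos_of_pos (by exact_mod_cast (hS p hp).pos) _
    simp only [hf]
    rw [div_mul_cancel₀ _ hp0.ne']
  rw [hsplit]
  refine mul_le_mul_of_nonneg_right ?_
    (Finset.prod_nonneg fun p _ => Real.rpow_nonneg (Nat.cast_nonneg p) _)
  rw [← Finset.prod_filter_mul_prod_filter_not S (fun p => p < N)]
  have hsmall : ∏ p ∈ S.filter (fun p => p < N), f p ≤ C := by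
    calc ∏ p ∈ S.filter (fun p => p < N), f p
        ≤ ∏ p ∈ S.filter (fun p => p < N), max 1 (f p) :=
          Finset.prod_le_prod (fun p hp => hf0 p (Finset.mem_filter.mp hp).1)
            fun p _ => le_max_right _ _
      _ ≤ C := by
          apply Finset.prod_le_prod_of_subset_of_one_le
          · intro p hp
            obtain ⟨hpS, hpN⟩ := Finset.mem_filter.mp hp
            exact Finset.mem_filter.mpr ⟨Finset.mem_range.mpr hpN, hS p hpS⟩
          · intro p _; exact zero_le_one.trans (le_max_left _ _)
          · intro p _ _; exact le_max_left _ _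
  have hlarge : ∏ p ∈ S.filter (fun p => ¬p < N), f p ≤ 1 := by
    refine Finset.prod_le_one (fun p hp => hf0 p (Finset.mem_filter.mp hp).1) fun p hp => ?_
    obtain ⟨hpS, hpN⟩ := Finset.mem_filter.mp hp
    have hp' := hS p hpS
    have hp0 : (0 : ℝ) < p := by exact_mod_cast hp'.pos
    have hpx : x₀ ≤ (p : ℝ) := (Nat.le_ceil x₀).trans (by exact_mod_cast not_lt.mp hpN)
    have h1 : 2 * A / δ ≤ (p : ℝ) ^ (δ / 2) := hx₀ (p : ℝ) hpx
    have h2 : Real.log p ≤ (p : ℝ) ^ (δ / 2) / (δ / 2) :=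
      Real.log_le_rpow_div hp0.le (half_pos hδ)
    have hpδ2 : 0 ≤ (p : ℝ) ^ (δ / 2) := Real.rpow_nonneg hp0.le _
    have h3 : A * Real.log p ≤ (p : ℝ) ^ δ := by
      calc A * Real.log p ≤ A * ((p : ℝ) ^ (δ / 2) / (δ / 2)) := mul_le_mul_of_nonneg_left h2 hA
        _ = (2 * A / δ) * (p : ℝ) ^ (δ / 2) := by rw [div_div_eq_mul_div]; ring
        _ ≤ (p : ℝ) ^ (δ / 2) * (p : ℝ) ^ (δ / 2) := mul_le_mul_of_nonneg_right h1 hpδ2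
        _ = (p : ℝ) ^ δ := by rw [← Real.rpow_add hp0, add_halves]
    simp only [hf]
    rw [div_le_one (Real.rpow_pos_of_pos hp0 _)]
    exact h3
  have h0 : 0 ≤ ∏ p ∈ S.filter (fun p => ¬p < N), f p :=
    Finset.prod_nonneg fun p hp => hf0 p (Finset.mem_filter.mp hp).1
  calc (∏ p ∈ S.filter (fun p => p < N), f p) * ∏ p ∈ S.filter (fun p => ¬p < N), f p
      ≤ C * 1 := mul_le_mul hsmall hlarge h0 (zero_le_one.trans hC1)
    _ = C := mul_one C

end Summit.ABC.ABC.Theorems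

end
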